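import Mathlib
import Summits.AtomisticToContinuum.Crystallization.Theorems.GappedShellCensusCleanLimitsHaveWindowsLayeredHexagon

/-!
# Exactly layered shells ⇒ exactly layered set, file 4: the caps of a complete layer

Crux `GappedShellCensus.CleanLimitsHaveWindows` (stmt-AtomisticToContinuum-15932), line `Sketch`, support for
`stub_layeredOfExactShells`.  Anchor `stub_layerCaps`: if a complete triangular layer `p₀ + A (ℤ u + ℤ v + L w + z e₃)`
lies in a set `Z` with the gap clause all of whose bond shells are exact slot models, then the layer `L + ε⁺` at
height `z + h⁺` and the layer `L + ε⁻` at height `z - h⁻` are complete as well (`ε± = ±1`, both bond lengths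
`√(a'²/3 + h±²)` in the radial band), and every bond-shell point of a layer site is a layer site or has height
`z + h⁺` or `z - h⁻`.

Proof.  No rigidity is needed: at a layer site `ℓ` the six layer neighbours form a regular hexagon inside the bond
shell, so (`stub_hexagonShell`) the shell is a slot model over THAT plane in a frame `B = A` or `A ∘ R_π` on the plane
with `B e₃ = A e₃`; in the frame `A` it is therefore a CAP CODE SET `laCap s⁺ s⁻` (the hexagon, an upper triangle
`±(w - T)` at height `h⁺`, a lower triangle `±(w - T)` at depth `h⁻`).  The cap datum `(s⁺, h⁺, s⁻, h⁻)` is constant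
along layer bonds (`cap_transfer`): the cap point of `ℓ` adjacent to `ℓ + A u` is a bond-shell point of `ℓ + A u`
off the plane, hence one of ITS cap points — same height, and (`decide`) same sign.  Induction over `ℤ²`.
-/

noncomputable section

namespace Summit.AtomisticToContinuum.Crystallization.Theorems.CleanHull

open Literature.MathematicalPhysics.StatisticalMechanics

/-! ## Cap codes (`decide`) -/

/-- CAP CODES: the hexagon, an upper triangle of sign `sp` and a lower triangle of sign `sm`
(`laCap true false = laCodeC`, `laCap true true = laCodeH`; the other two are their half turns). [folklore] -/
def laCap (sp sm : Bool) : Fin 12 → ℤ × ℤ × ℤ :=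
  ![(3, 0, 0), (-3, 0, 0), (0, 3, 0), (0, -3, 0), (3, -3, 0), (-3, 3, 0),
    (laSgn sp, laSgn sp, 1), (-2 * laSgn sp, laSgn sp, 1), (laSgn sp, -2 * laSgn sp, 1),
    (laSgn sm, laSgn sm, -1), (-2 * laSgn sm, laSgn sm, -1), (laSgn sm, -2 * laSgn sm, -1)]

/-- The four slot-model code sets (two types; frame `A`, or `A ∘ R_π` i.e. half-turned codes) are cap code sets.
[folklore] -/
theorem laCap_repr (t s : Bool) :
    (∀ k : Fin 12, ∃ k' : Fin 12,
      (if s then laCode t k else laRpi (laCode t k)) = laCap s (if t then !s else s) k') ∧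
    (∀ k' : Fin 12, ∃ k : Fin 12,
      (if s then laCode t k else laRpi (laCode t k)) = laCap s (if t then !s else s) k') := by
  revert t s; decide

/-- Levels of cap codes are `0, 1, -1`; level-`0` cap codes are lattice vectors. [folklore] -/
theorem laCap_level (sp sm : Bool) (k : Fin 12) :
    ((laCap sp sm k).2.2 = 0 ∧ 3 ∣ (laCap sp sm k).1 ∧ 3 ∣ (laCap sp sm k).2.1) ∨
      (laCap sp sm k).2.2 = 1 ∨ (laCap sp sm k).2.2 = -1 := by
  revert sp sm k; decide

/-- **Cap transfer, combinatorial part.** Next to the in-plane code `laCodeC m` (`m = 0`: `u`, `m = 2`: `v`) there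
is an adjacent upper (lower) cap code, and a cap code set containing its translate by `-laCodeC m` at the same level
has the same upper (lower) sign. [folklore] -/
theorem laCap_transfer (sp sm sp' sm' : Bool) (m : Fin 12) (hm : m = 0 ∨ m = 2) :
    (∃ k : Fin 12, (laCap sp sm k).2.2 = 1 ∧ laQn (laCodeC m) (laCap sp sm k) = 3 ∧
      ∀ k' : Fin 12, (laCap sp' sm' k').2.2 = 1 → (laCap sp' sm' k').1 = (laCap sp sm k).1 - (laCodeC m).1 →
        (laCap sp' sm' k').2.1 = (laCap sp sm k).2.1 - (laCodeC m).2.1 → sp' = sp) ∧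
    (∃ k : Fin 12, (laCap sp sm k).2.2 = -1 ∧ laQn (laCodeC m) (laCap sp sm k) = 3 ∧
      ∀ k' : Fin 12, (laCap sp' sm' k').2.2 = -1 → (laCap sp' sm' k').1 = (laCap sp sm k).1 - (laCodeC m).1 →
        (laCap sp' sm' k').2.1 = (laCap sp sm k).2.1 - (laCodeC m).2.1 → sm' = sm) := by
  rcases hm with rfl | rfl <;> revert sp sm sp' sm' <;> decide

/-! ## Geometry of cap code sets -/

/-- `u` and `v` as code points (any heights). [folklore] -/
theorem laPt_uv (a' kp km : ℝ) :
    laPt a' kp km (laCodeC 0) = triangularVec₁ a' ∧ laPt a' kp km (laCodeC 2) = triangularVec₂ a' := by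
  constructor <;> simp [laPt, laHt, laCodeC]

/-- A frame `B` with `B e₃ = A e₃` and `B = ±A` on `u, v` maps a code point to the `A`-image of the same code point
or of its half turn. [folklore] -/
theorem frame_laPt (a' kp km : ℝ) (A B : EuclideanSpace ℝ (Fin 3) →ₗᵢ[ℝ] EuclideanSpace ℝ (Fin 3)) (s : Bool)
    (he : B (layerNormal 1) = A (layerNormal 1))
    (hu : B (triangularVec₁ a') = (laSgn s : ℝ) • A (triangularVec₁ a'))
    (hv : B (triangularVec₂ a') = (laSgn s : ℝ) • A (triangularVec₂ a')) (c : ℤ × ℤ × ℤ) :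
    B (laPt a' kp km c) = A (laPt a' kp km (if s then c else laRpi c)) := by
  cases s <;> simp only [laSgn, laPt, laRpi, map_add, LinearIsometry.map_smul, hu, hv, he, Int.cast_neg,
    Int.cast_one, if_true, if_false, Bool.false_eq_true] <;> module

/-- The height of a layer vector `i u + j v + L w + z e₃` is `z`. [folklore] -/
theorem inner_layerVec_layerNormal (a' i j L z : ℝ) :
    inner ℝ (i • triangularVec₁ a' + j • triangularVec₂ a' + L • barlowOffset a' + z • layerNormal 1)
      (layerNormal (1 : ℝ)) = z := by
  simp [EuclideanSpace.inner_eq_star_dotProduct, triangularVec₁, triangularVec₂, barlowOffset, layerNormal,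
    dotProduct, Fin.sum_univ_three]

/-- A layer vector plus a code point is a layer-type vector: `w = (u + v)/3`. [folklore] -/
theorem layerVec_add_laPt (a' kp km : ℝ) (i j L : ℤ) (z : ℝ) (c : ℤ × ℤ × ℤ) :
    ((i : ℝ) • triangularVec₁ a' + (j : ℝ) • triangularVec₂ a' + (L : ℝ) • barlowOffset a' + z • layerNormal 1) +
        laPt a' kp km c =
      ((i : ℝ) + ((c.1 - c.2.1 : ℤ) : ℝ) / 3) • triangularVec₁ a' + (j : ℝ) • triangularVec₂ a' +
        ((L : ℝ) + c.2.1) • barlowOffset a' + (z + laHt kp km c.2.2) • layerNormal 1 := by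
  have hw : barlowOffset a' = (1 / 3 : ℝ) • (triangularVec₁ a' + triangularVec₂ a') := by
    rw [← three_smul_barlowOffset, smul_smul]; norm_num
  rw [hw, laPt]
  push_cast
  module

/-! ## Caps at one layer site -/

/-- **Caps at a layer site.** If `ℓ ∈ Z` and its six hexagon neighbours `ℓ ± A u, ℓ ± A v, ℓ ± A (u - v)` lie in
`Z` (spacing `a'` in the band), then the bond shell of `ℓ` is a cap code set in the frame `A`, with both interlayer
bond lengths in the band. [folklore] -/
theorem caps_at (Z : Set (EuclideanSpace ℝ (Fin 3))) (a : ℝ) (ha : 0 < a)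
    (hgap : ∀ y ∈ Z, ∀ w ∈ Z, w ≠ y → a * (1 - 1 / 50) ≤ dist y w ∧
      (dist y w ≤ a * (1 + 1 / 50) ∨ a * (63 / 50) ≤ dist y w))
    (hexact : ∀ p ∈ Z, ∃ (a' hp' hm' : ℝ) (A : EuclideanSpace ℝ (Fin 3) →ₗᵢ[ℝ] EuclideanSpace ℝ (Fin 3)),
      0 < a' ∧ 0 < hp' ∧ 0 < hm' ∧
      ((bondShell a Z p = Set.range fun k : Fin 12 => p + A (slotC a' hp' hm' k)) ∨
       (bondShell a Z p = Set.range fun k : Fin 12 => p + A (slotH a' hp' hm' k))))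
    (A : EuclideanSpace ℝ (Fin 3) →ₗᵢ[ℝ] EuclideanSpace ℝ (Fin 3)) (a' : ℝ)
    (hlo : a * (1 - 1 / 50) ≤ a') (hhi : a' ≤ a * (1 + 1 / 50)) (ℓ : EuclideanSpace ℝ (Fin 3)) (hℓ : ℓ ∈ Z)
    (h1 : ℓ + A (triangularVec₁ a') ∈ Z) (h2 : ℓ - A (triangularVec₁ a') ∈ Z)
    (h3 : ℓ + A (triangularVec₂ a') ∈ Z) (h4 : ℓ - A (triangularVec₂ a') ∈ Z)
    (h5 : ℓ + A (triangularVec₁ a' - triangularVec₂ a') ∈ Z)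
    (h6 : ℓ - A (triangularVec₁ a' - triangularVec₂ a') ∈ Z) :
    ∃ (sp sm : Bool) (hp hm : ℝ), 0 < hp ∧ 0 < hm ∧
      (a * (1 - 1 / 50)) ^ 2 ≤ a' ^ 2 / 3 + hp ^ 2 ∧ a' ^ 2 / 3 + hp ^ 2 ≤ (a * (1 + 1 / 50)) ^ 2 ∧
      (a * (1 - 1 / 50)) ^ 2 ≤ a' ^ 2 / 3 + hm ^ 2 ∧ a' ^ 2 / 3 + hm ^ 2 ≤ (a * (1 + 1 / 50)) ^ 2 ∧
      bondShell a Z ℓ = Set.range fun k : Fin 12 => ℓ + A (laPt a' hp hm (laCap sp sm k)) := by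
  have ha' : 0 < a' := lt_of_lt_of_le (by positivity) hlo
  obtain ⟨a'', kp, km, A', ha'', hkp, hkm, hS⟩ := hexact ℓ hℓ
  obtain ⟨nu, nv, duv⟩ := la_norm_uv ha'
  rw [dist_eq_norm] at duv
  -- the hexagon lies in the bond shell
  have mem : ∀ t : EuclideanSpace ℝ (Fin 3), ‖t‖ = a' → ℓ + A t ∈ Z → ℓ + A t ∈ bondShell a Z ℓ := by
    intro t ht hZ
    refine ⟨hZ, fun h => ?_, ?_⟩
    · have h0 : A t = 0 := by simpa using h
      have := congrArg norm h0
      rw [A.norm_map, ht, norm_zero] at this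
      linarith
    · rw [dist_comm, dist_eq_norm, add_sub_cancel_left, A.norm_map, ht]
      exact hhi
  have mem' : ∀ t : EuclideanSpace ℝ (Fin 3), ‖t‖ = a' → ℓ - A t ∈ Z → ℓ - A t ∈ bondShell a Z ℓ := by
    intro t ht hZ
    rw [sub_eq_add_neg, ← map_neg] at hZ ⊢
    exact mem (-t) (by rw [norm_neg, ht]) hZ
  obtain ⟨hp, hm, B, hpos, hmpos, hBe, hBuv, hSB⟩ := stub_hexagonShell (bondShell a Z ℓ) ℓ a'' kp km A' ha'' hkp
    hkm hS a' A ha' (mem _ nu h1) (mem' _ nu h2) (mem _ nv h3) (mem' _ nv h4) (mem _ duv h5) (mem' _ duv h6)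
  obtain ⟨-, -, b1, b2, b3, b4⟩ := stub_exactBand Z a ha hgap ℓ hℓ a' hp hm B ha' hpos hmpos hSB
  obtain ⟨s, hu, hv⟩ : ∃ s : Bool, B (triangularVec₁ a') = (laSgn s : ℝ) • A (triangularVec₁ a') ∧
      B (triangularVec₂ a') = (laSgn s : ℝ) • A (triangularVec₂ a') := by
    rcases hBuv with ⟨e1, e2⟩ | ⟨e1, e2⟩
    · exact ⟨true, by simp [laSgn, e1], by simp [laSgn, e2]⟩
    · exact ⟨false, by simp [laSgn, e1], by simp [laSgn, e2]⟩
  obtain ⟨t, hSt⟩ : ∃ t : Bool, bondShell a Z ℓ = Set.range fun k : Fin 12 => ℓ + B (laPt a' hp hm (laCode t k)) := by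
    rcases hSB with h | h
    · exact ⟨true, by rw [h]; exact congrArg _ (funext fun i => by rw [slotC_eq_laPt]; rfl)⟩
    · exact ⟨false, by rw [h]; exact congrArg _ (funext fun i => by rw [slotH_eq_laPt]; rfl)⟩
  refine ⟨s, (if t then !s else s), hp, hm, hpos, hmpos, b1, b2, b3, b4, ?_⟩
  obtain ⟨fwd, bwd⟩ := laCap_repr t s
  rw [hSt]
  ext x
  simp only [Set.mem_range]
  constructor
  · rintro ⟨k, rfl⟩
    obtain ⟨k', hk'⟩ := fwd k
    exact ⟨k', by rw [frame_laPt a' hp hm A B s hBe hu hv, hk']⟩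
  · rintro ⟨k', rfl⟩
    obtain ⟨k, hk⟩ := bwd k'
    exact ⟨k, by rw [frame_laPt a' hp hm A B s hBe hu hv, hk]⟩

/-! ## Transfer of the cap datum along a layer bond -/

/-- **Cap transfer.** If the bond shells of `ℓ` and of its layer neighbour `ℓ + A u` (or `ℓ + A v`) are cap code
sets in the frame `A` (the cap bond lengths of `ℓ` in the band), the two cap data coincide. [folklore] -/
theorem cap_transfer (Z : Set (EuclideanSpace ℝ (Fin 3))) (a : ℝ) (ha : 0 < a)
    (A : EuclideanSpace ℝ (Fin 3) →ₗᵢ[ℝ] EuclideanSpace ℝ (Fin 3)) (a' hp hm hp' hm' : ℝ) (ha' : 0 < a')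
    (hhp : 0 < hp) (hhm : 0 < hm) (hhp' : 0 < hp') (hhm' : 0 < hm')
    (b2 : a' ^ 2 / 3 + hp ^ 2 ≤ (a * (1 + 1 / 50)) ^ 2) (b4 : a' ^ 2 / 3 + hm ^ 2 ≤ (a * (1 + 1 / 50)) ^ 2)
    (sp sm sp' sm' : Bool) (m : Fin 12) (hm0 : m = 0 ∨ m = 2) (ℓ dv : EuclideanSpace ℝ (Fin 3))
    (hdv : dv = laPt a' hp hm (laCodeC m))
    (hS : bondShell a Z ℓ = Set.range fun k : Fin 12 => ℓ + A (laPt a' hp hm (laCap sp sm k)))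
    (hS' : bondShell a Z (ℓ + A dv) =
      Set.range fun k : Fin 12 => ℓ + A dv + A (laPt a' hp' hm' (laCap sp' sm' k))) :
    sp' = sp ∧ hp' = hp ∧ sm' = sm ∧ hm' = hm := by
  obtain ⟨ht0, ht1, ht2⟩ := laHt_values hp hm
  obtain ⟨ht0', ht1', ht2'⟩ := laHt_values hp' hm'
  have hd0 : (laCodeC m).2.2 = 0 := by rcases hm0 with rfl | rfl <;> rfl
  subst hdv
  -- a cap point of `ℓ` adjacent to `ℓ'` reappears, at the same signed height, translated, among the codes of `ℓ'`
  have key : ∀ k : Fin 12, (laCap sp sm k).2.2 ≠ 0 → laQn (laCodeC m) (laCap sp sm k) = 3 →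
      laHt hp hm (laCap sp sm k).2.2 ^ 2 + a' ^ 2 / 3 ≤ (a * (1 + 1 / 50)) ^ 2 →
      ∃ k' : Fin 12, (laCap sp' sm' k').1 = (laCap sp sm k).1 - (laCodeC m).1 ∧
        (laCap sp' sm' k').2.1 = (laCap sp sm k).2.1 - (laCodeC m).2.1 ∧
        laHt hp' hm' (laCap sp' sm' k').2.2 = laHt hp hm (laCap sp sm k).2.2 := by
    intro k hk0 hQ hband
    have hcZ : ℓ + A (laPt a' hp hm (laCap sp sm k)) ∈ bondShell a Z ℓ := by rw [hS]; exact ⟨k, rfl⟩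
    have hne : laHt hp hm (laCap sp sm k).2.2 ≠ 0 := by
      rcases laCap_level sp sm k with ⟨h, -⟩ | h | h
      · exact absurd h hk0
      · rw [h, ht1]; exact hhp.ne'
      · rw [h, ht2]; exact (neg_ne_zero.2 hhm.ne')
    have hmem : ℓ + A (laPt a' hp hm (laCap sp sm k)) ∈ bondShell a Z (ℓ + A (laPt a' hp hm (laCodeC m))) := by
      refine ⟨hcZ.1, fun h => ?_, ?_⟩
      · have h' : laPt a' hp hm (laCap sp sm k) = laPt a' hp hm (laCodeC m) := A.injective (add_left_cancel h)
        have := congrArg (fun v => inner ℝ v (layerNormal (1 : ℝ))) h'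
        simp only [inner_laPt_layerNormal, hd0, ht0] at this
        exact hne this
      · rw [dist_add_left, A.dist_map]
        refine (pow_le_pow_iff_left₀ dist_nonneg (by positivity) two_ne_zero).1 ?_
        rw [dist_laPt_sq, hQ, hd0, ht0]
        push_cast
        nlinarith [hband]
    rw [hS'] at hmem
    obtain ⟨k', hk'⟩ := hmem
    have e : laPt a' hp' hm' (laCap sp' sm' k') = laPt a' hp hm (laCap sp sm k) - laPt a' hp hm (laCodeC m) := by
      apply A.injective
      rw [map_sub]
      have := hk'
      simp only at this
      rw [add_assoc] at this
      rw [← add_left_cancel this, add_sub_cancel_left]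
    rw [laPt_sub, laPt] at e
    obtain ⟨e1, e2, e3⟩ := la_coords ha'.ne' e
    refine ⟨k', ?_, ?_, ?_⟩
    · exact_mod_cast (by linarith : ((laCap sp' sm' k').1 : ℝ) = ((laCap sp sm k).1 - (laCodeC m).1 : ℤ))
    · exact_mod_cast (by linarith : ((laCap sp' sm' k').2.1 : ℝ) = ((laCap sp sm k).2.1 - (laCodeC m).2.1 : ℤ))
    · rw [e3, hd0, ht0, sub_zero]
  obtain ⟨⟨k, hk1, hkQ, hall⟩, ⟨l, hl1, hlQ, hall'⟩⟩ := laCap_transfer sp sm sp' sm' m hm0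
  obtain ⟨k', p1, p2, p3⟩ := key k (by rw [hk1]; decide) hkQ (by rw [hk1, ht1]; linarith)
  obtain ⟨l', q1, q2, q3⟩ := key l (by rw [hl1]; decide) hlQ (by rw [hl1, ht2, neg_sq]; linarith)
  rw [hk1, ht1] at p3
  rw [hl1, ht2] at q3
  have lk' : (laCap sp' sm' k').2.2 = 1 := by
    rcases laCap_level sp' sm' k' with ⟨h, -⟩ | h | h
    · rw [h, ht0'] at p3; linarith
    · exact h
    · rw [h, ht2'] at p3; linarith
  have ll' : (laCap sp' sm' l').2.2 = -1 := by
    rcases laCap_level sp' sm' l' with ⟨h, -⟩ | h | h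
    · rw [h, ht0'] at q3; linarith
    · rw [h, ht1'] at q3; linarith
    · exact h
  refine ⟨hall k' lk' p1 p2, ?_, hall' l' ll' q1 q2, ?_⟩
  · rw [lk', ht1'] at p3; exact p3
  · rw [ll', ht2'] at q3; linarith

/-! ## The anchor -/

/-- **Caps of a complete layer.** If the complete triangular layer `p₀ + A (ℤ u + ℤ v + L w + z e₃)` (spacing `a'`
in the band) lies in a set `Z` with the gap clause all of whose bond shells are exact slot models, then for signs
`ε± = ±1` and heights `h± > 0` with `√(a'²/3 + h±²)` in the band, the layers `L + ε⁺` at height `z + h⁺` and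
`L + ε⁻` at height `z - h⁻` are complete, and every bond-shell point of a layer site is a layer site (height `z`) or
has height `z + h⁺` or `z - h⁻`. [folklore] -/
theorem stub_layerCaps (Z : Set (EuclideanSpace ℝ (Fin 3))) (a : ℝ) (ha : 0 < a)
    (hgap : ∀ y ∈ Z, ∀ w ∈ Z, w ≠ y → a * (1 - 1 / 50) ≤ dist y w ∧
      (dist y w ≤ a * (1 + 1 / 50) ∨ a * (63 / 50) ≤ dist y w))
    (hexact : ∀ p ∈ Z, ∃ (a' hp' hm' : ℝ) (A : EuclideanSpace ℝ (Fin 3) →ₗᵢ[ℝ] EuclideanSpace ℝ (Fin 3)),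
      0 < a' ∧ 0 < hp' ∧ 0 < hm' ∧
      ((bondShell a Z p = Set.range fun k : Fin 12 => p + A (slotC a' hp' hm' k)) ∨
       (bondShell a Z p = Set.range fun k : Fin 12 => p + A (slotH a' hp' hm' k))))
    (p₀ : EuclideanSpace ℝ (Fin 3)) (a' : ℝ) (A : EuclideanSpace ℝ (Fin 3) →ₗᵢ[ℝ] EuclideanSpace ℝ (Fin 3))
    (hlo : a * (1 - 1 / 50) ≤ a') (hhi : a' ≤ a * (1 + 1 / 50)) (L : ℤ) (z : ℝ)
    (hlayer : ∀ i j : ℤ, A (((i : ℝ) • triangularVec₁ a') + ((j : ℝ) • triangularVec₂ a') +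
      ((L : ℝ) • barlowOffset a') + (z • layerNormal 1)) + p₀ ∈ Z) :
    ∃ (εp εm : ℤ) (hp' hm' : ℝ), (εp = 1 ∨ εp = -1) ∧ (εm = 1 ∨ εm = -1) ∧ 0 < hp' ∧ 0 < hm' ∧
      (a * (1 - 1 / 50)) ^ 2 ≤ a' ^ 2 / 3 + hp' ^ 2 ∧ a' ^ 2 / 3 + hp' ^ 2 ≤ (a * (1 + 1 / 50)) ^ 2 ∧
      (a * (1 - 1 / 50)) ^ 2 ≤ a' ^ 2 / 3 + hm' ^ 2 ∧ a' ^ 2 / 3 + hm' ^ 2 ≤ (a * (1 + 1 / 50)) ^ 2 ∧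
      (∀ i j : ℤ, A (((i : ℝ) • triangularVec₁ a') + ((j : ℝ) • triangularVec₂ a') +
        (((L + εp : ℤ) : ℝ) • barlowOffset a') + ((z + hp') • layerNormal 1)) + p₀ ∈ Z) ∧
      (∀ i j : ℤ, A (((i : ℝ) • triangularVec₁ a') + ((j : ℝ) • triangularVec₂ a') +
        (((L + εm : ℤ) : ℝ) • barlowOffset a') + ((z - hm') • layerNormal 1)) + p₀ ∈ Z) ∧
      (∀ i j : ℤ, ∀ x ∈ bondShell a Z (A (((i : ℝ) • triangularVec₁ a') + ((j : ℝ) • triangularVec₂ a') +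
          ((L : ℝ) • barlowOffset a') + (z • layerNormal 1)) + p₀),
        (inner ℝ (x - p₀) (A (layerNormal 1)) = z ∧ ∃ i' j' : ℤ,
            x = A (((i' : ℝ) • triangularVec₁ a') + ((j' : ℝ) • triangularVec₂ a') +
              ((L : ℝ) • barlowOffset a') + (z • layerNormal 1)) + p₀) ∨
          inner ℝ (x - p₀) (A (layerNormal 1)) = z + hp' ∨ inner ℝ (x - p₀) (A (layerNormal 1)) = z - hm') := by
  have ha' : 0 < a' := lt_of_lt_of_le (by positivity) hlo
  -- the layer sites
  obtain ⟨ℓ, hℓ⟩ : ∃ ℓ : ℤ → ℤ → EuclideanSpace ℝ (Fin 3), ∀ i j, ℓ i j = A (((i : ℝ) • triangularVec₁ a') +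
      ((j : ℝ) • triangularVec₂ a') + ((L : ℝ) • barlowOffset a') + (z • layerNormal 1)) + p₀ := ⟨_, fun _ _ => rfl⟩
  have hZ : ∀ i j, ℓ i j ∈ Z := fun i j => by rw [hℓ]; exact hlayer i j
  have hshift : ∀ i j m n : ℤ, ℓ (i + m) (j + n) = ℓ i j + A ((m : ℝ) • triangularVec₁ a' + (n : ℝ) • triangularVec₂ a') := by
    intro i j m n
    simp only [hℓ, Int.cast_add, map_add, LinearIsometry.map_smul, add_smul]
    abel
  have hex : ∀ i j m n : ℤ, ℓ i j + A ((m : ℝ) • triangularVec₁ a' + (n : ℝ) • triangularVec₂ a') ∈ Z :=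
    fun i j m n => by rw [← hshift]; exact hZ _ _
  have hcap : ∀ i j, ∃ (sp sm : Bool) (hp hm : ℝ), 0 < hp ∧ 0 < hm ∧
      (a * (1 - 1 / 50)) ^ 2 ≤ a' ^ 2 / 3 + hp ^ 2 ∧ a' ^ 2 / 3 + hp ^ 2 ≤ (a * (1 + 1 / 50)) ^ 2 ∧
      (a * (1 - 1 / 50)) ^ 2 ≤ a' ^ 2 / 3 + hm ^ 2 ∧ a' ^ 2 / 3 + hm ^ 2 ≤ (a * (1 + 1 / 50)) ^ 2 ∧
      bondShell a Z (ℓ i j) = Set.range fun k : Fin 12 => ℓ i j + A (laPt a' hp hm (laCap sp sm k)) := by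
    intro i j
    refine caps_at Z a ha hgap hexact A a' hlo hhi (ℓ i j) (hZ i j) ?_ ?_ ?_ ?_ ?_ ?_
    · convert hex i j 1 0 using 2; simp
    · convert hex i j (-1) 0 using 1; simp [sub_eq_add_neg]
    · convert hex i j 0 1 using 2; simp
    · convert hex i j 0 (-1) using 1; simp [sub_eq_add_neg]
    · convert hex i j 1 (-1) using 2; simp [sub_eq_add_neg]
    · convert hex i j (-1) 1 using 1; simp only [map_add, map_sub, LinearIsometry.map_smul]; push_cast; module
  obtain ⟨sp, sm, hp, hm, hpos, hmpos, b1, b2, b3, b4, h00⟩ := hcap 0 0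
  -- propagation along layer bonds
  have P_iff : ∀ (i j i' j' : ℤ) (m : Fin 12), (m = 0 ∨ m = 2) → ∀ dv : EuclideanSpace ℝ (Fin 3),
      (∀ kp km : ℝ, dv = laPt a' kp km (laCodeC m)) → ℓ i' j' = ℓ i j + A dv →
      ((bondShell a Z (ℓ i j) = Set.range fun k : Fin 12 => ℓ i j + A (laPt a' hp hm (laCap sp sm k))) ↔
       (bondShell a Z (ℓ i' j') = Set.range fun k : Fin 12 => ℓ i' j' + A (laPt a' hp hm (laCap sp sm k)))) := by
    intro i j i' j' m hm0 dv hdv he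
    rw [he]
    constructor
    · intro hS
      obtain ⟨sp', sm', hp', hm', hpos', hmpos', -, -, -, -, hS'⟩ := hcap i' j'
      rw [he] at hS'
      obtain ⟨e1, e2, e3, e4⟩ := cap_transfer Z a ha A a' hp hm hp' hm' ha' hpos hmpos hpos' hmpos' b2 b4
        sp sm sp' sm' m hm0 (ℓ i j) dv (hdv hp hm) hS hS'
      rw [hS', e1, e2, e3, e4]
    · intro hS'
      obtain ⟨sp', sm', hp', hm', hpos', hmpos', -, b2', -, b4', hS⟩ := hcap i j
      obtain ⟨e1, e2, e3, e4⟩ := cap_transfer Z a ha A a' hp' hm' hp hm ha' hpos' hmpos' hpos hmpos b2' b4'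
        sp' sm' sp sm m hm0 (ℓ i j) dv (hdv hp' hm') hS hS'
      rw [hS, ← e1, ← e2, ← e3, ← e4]
  have hu' : ∀ i j, (bondShell a Z (ℓ i j) = Set.range fun k : Fin 12 => ℓ i j + A (laPt a' hp hm (laCap sp sm k))) ↔
      (bondShell a Z (ℓ (i + 1) j) = Set.range fun k : Fin 12 => ℓ (i + 1) j + A (laPt a' hp hm (laCap sp sm k))) :=
    fun i j => P_iff i j (i + 1) j 0 (Or.inl rfl) _ (fun kp km => ((laPt_uv a' kp km).1).symm)
      (by convert hshift i j 1 0 using 2 <;> simp)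
  have hv' : ∀ i j, (bondShell a Z (ℓ i j) = Set.range fun k : Fin 12 => ℓ i j + A (laPt a' hp hm (laCap sp sm k))) ↔
      (bondShell a Z (ℓ i (j + 1)) = Set.range fun k : Fin 12 => ℓ i (j + 1) + A (laPt a' hp hm (laCap sp sm k))) :=
    fun i j => P_iff i j i (j + 1) 2 (Or.inr rfl) _ (fun kp km => ((laPt_uv a' kp km).2).symm)
      (by convert hshift i j 0 1 using 2 <;> simp)
  have hall : ∀ i j, bondShell a Z (ℓ i j) = Set.range fun k : Fin 12 => ℓ i j + A (laPt a' hp hm (laCap sp sm k)) := by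
    have col : ∀ j, bondShell a Z (ℓ 0 j) = Set.range fun k : Fin 12 => ℓ 0 j + A (laPt a' hp hm (laCap sp sm k)) := by
      intro j
      induction j using Int.induction_on with
      | zero => exact h00
      | succ n ih => exact (hv' 0 n).1 ih
      | pred n ih => exact (hv' 0 (-(n : ℤ) - 1)).2 (by rwa [sub_add_cancel])
    intro i
    induction i using Int.induction_on with
    | zero => exact col
    | succ n ih => intro j; exact (hu' n j).1 (ih j)
    | pred n ih => intro j; exact (hu' (-(n : ℤ) - 1) j).2 (by rw [sub_add_cancel]; exact ih j)
  -- read off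
  obtain ⟨ht0, ht1, ht2⟩ := laHt_values hp hm
  have hsgn : ∀ s : Bool, laSgn s = 1 ∨ laSgn s = -1 := fun s => by cases s <;> simp [laSgn]
  have hpt : ∀ (i j : ℤ) (k : Fin 12), ℓ i j + A (laPt a' hp hm (laCap sp sm k)) =
      A ((((i : ℝ) + (((laCap sp sm k).1 - (laCap sp sm k).2.1 : ℤ) : ℝ) / 3) • triangularVec₁ a') +
        ((j : ℝ) • triangularVec₂ a') + (((L : ℝ) + (laCap sp sm k).2.1) • barlowOffset a') +
        ((z + laHt hp hm (laCap sp sm k).2.2) • layerNormal 1)) + p₀ := by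
    intro i j k
    rw [hℓ, add_right_comm, ← map_add, layerVec_add_laPt]
  have hmemk : ∀ (i j : ℤ) (k : Fin 12), ℓ i j + A (laPt a' hp hm (laCap sp sm k)) ∈ Z := by
    intro i j k
    have : ℓ i j + A (laPt a' hp hm (laCap sp sm k)) ∈ bondShell a Z (ℓ i j) := by rw [hall]; exact ⟨k, rfl⟩
    exact this.1
  refine ⟨laSgn sp, laSgn sm, hp, hm, hsgn sp, hsgn sm, hpos, hmpos, b1, b2, b3, b4, ?_, ?_, ?_⟩
  · intro i j
    have h := hmemk i j 6
    rw [hpt] at h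
    convert h using 4 <;> simp [laCap, ht1]
  · intro i j
    have h := hmemk i j 9
    rw [hpt] at h
    convert h using 4 <;> simp [laCap, ht2, sub_eq_add_neg]
  · intro i j x hx
    rw [← hℓ, hall] at hx
    obtain ⟨k, rfl⟩ := hx
    have hin : inner ℝ (ℓ i j + A (laPt a' hp hm (laCap sp sm k)) - p₀) (A (layerNormal 1)) =
        z + laHt hp hm (laCap sp sm k).2.2 := by
      rw [hpt, add_sub_cancel_right, A.inner_map_map, inner_layerVec_layerNormal]
    simp only [hin]
    rcases laCap_level sp sm k with ⟨h0, ⟨m, hm1⟩, ⟨n, hn1⟩⟩ | h1 | h1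
    · left
      refine ⟨by rw [h0, ht0, add_zero], i + m, j + n, ?_⟩
      rw [← hℓ, hshift, laPt, h0, ht0, hm1, hn1, zero_smul, add_zero]
      push_cast
      congr 2
      module
    · right; left; rw [h1, ht1]
    · right; right; rw [h1, ht2]; ring

end Summit.AtomisticToContinuum.Crystallization.Theorems.CleanHull

end
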